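import Summits.QuantumFields.YangMills.Theorems.BalabanUVNodesN15KingModelTorusReflectionPositivity
import Literature.Probability.LatticeModels.ReflectionPositivityPushforward
import HarnessLib

/-!
# BalabanUVNodes ∕ N15 — THE KING-MODEL RUNG (PART Ϗ-e): BLOCK AVERAGING OVER REFLECTION-SYMMETRIC BLOCKS PRESERVES REFLECTION POSITIVITY —
# King's block mean `Q` pushes EVERY reflection-positive law of fine-lattice fields (torus `Π ℤ∕(N·M_μ)`, block-face reflection, fine half torus) to a
# reflection-positive law of unit-lattice block fields (torus `Π ℤ∕M_μ`, `M_κ` even); in particular a second, measure-theoretic proof for the block averages of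
# the fine free field
# (Track A, DAG node N15 = NE2; FAN-OUT v1.1 §N15 s3 «KING-MODEL RUNG»; count-neutral)

HONEST FRAMING.  Count-neutral (cell `pub-ymgap`, seat `pub-ymgap-dag-n15-e` g37; `--supports stmt-QuantumFields-27366 --as helper` = K3⁸).  King's block mean `(Qφ)(b) =
N^{−d}Σ_{x∈B(b)}φ(x)` ([King1986] (2.10) p.652) between the fine torus `Π ℤ∕(N·M_μ)` and the unit torus `Π ℤ∕M_μ` (`King1986.Torus.Qmat`).  With the block-face
reflections `σ_κ` (dag-n15-a `torRefl`) on both lattices and `M_κ` EVEN, the map `φ ↦ Qφ` is (i) measurable, (ii) EQUIVARIANT — `Q(φ∘σ_fine) = (Qφ)∘σ_unit`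
(★ `Qmat_mulVec_configReflect`, from dag-n15-d's «blocks go to blocks» and part Ϙ-f's `Qmat_torRefl`) — and (iii) HALF-LOCAL — every block coordinate in the unit half
torus `{val b_κ < M_κ∕2}` is measurable in the fine coordinates of the fine half torus `{val x_κ < N·M_κ∕2}` (★ `measurable_Qmat_coord_half`, part Ϗ-b's
`mem_half_fine_iff`).  Hence, by the new Literature push-forward theorem (`ReflectionPositivityPushforward`), ★★★ **`blockAverage_isReflectionPositive`**: for EVERY
measure `μ` on fine configurations that is reflection positive for `(σ_κ, fine half)`, the law `Q_*μ` of its block averages is reflection positive for `(σ_κ, unit half)`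
on ALL bounded half-torus observables; likewise reflection invariance (`blockAverage_isReflectionInvariant`) and the real form.  Applied to King's fine free field
`ρ_B dφ` (part Ϗ-a): ★★ `fineFreeBlockAverage_isReflectionPositive` — the law of `Qφ`, `φ ∼ N(0, B⁻¹)`, is reflection positive (a second, structural proof of the
covariance statement of part Ϗ-b, now for the push-forward measure).  NOT a statement about the RG block field `ψ = Qφ + noise` (that is part Ϗ-b, by the precision
criterion); NOT Bałaban's covariant averages; NOT a node discharge; nothing continuum ∕ `ℝ⁴` ∕ OS axioms ∕ mass gap ∕ Clay.  0 `sorry`, 0 `def`.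

WHAT THIS FILE PROVES (kernel).  §1 `measurable_mulVec_real`, `Qmat_apply_torRefl_right`, ★ `Qmat_mulVec_configReflect`, ★ `measurable_Qmat_coord_half`,
`measurable_Qmat_positiveEvents`; §2 ★★★ **`blockAverage_isReflectionPositive`**, `blockAverage_isReflectionPositiveReal`, `blockAverage_isReflectionInvariant`;
§3 ★★ `fineFreeBlockAverage_isReflectionPositive`, `fineFreeBlockAverage_isReflectionInvariant`.

Locators (use): [King1986] (2.10) p.652, (2.13) p.653, (4.4) p.670; FILS 1978 §2, Thm. 2.1; Biskup 2009 §5.1 Def. 5.2, Lemma 5.3; Glimm–Jaffe 1987 §7.10 Thm. 7.10.3.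
-/

noncomputable section

open scoped BigOperators
open Finset Matrix MeasureTheory

namespace Summit.QuantumFields.YangMills.BalabanUVNodes.N15KingModelRung.TorusRP

open Literature.MathematicalPhysics.QuantumFieldTheory (IsPosSemidefKernel gaussianFieldOfKernel)
open Literature.MathematicalPhysics.QuantumFieldTheory.Balaban1983to89.B5Prop11Plancherel (Tor fine)
open Literature.MathematicalPhysics.QuantumFieldTheory.King1986.Torus (lapF lapF_coercive Qmat blockOf)
open Literature.Probability.LatticeModels (IsReflectionPositive IsReflectionPositiveReal IsReflectionInvariant positiveEvents configReflect configReflect_apply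
  measurable_positiveEvents_of_coord)
open Summit.QuantumFields.YangMills.BalabanUVNodes.N15.TwoGrid (torRefl torRefl_torRefl torRefl_injective sum_torRefl)
open Summit.QuantumFields.YangMills.BalabanUVNodes.N15KingModelRung.Curved (Qmat_torRefl)
open Summit.QuantumFields.YangMills.BalabanUVNodes.N15KingModelRung.FreeField (gaussLaw gaussLaw_eq_gaussianFieldOfKernel)

variable {d : ℕ}

/-! ## §1 The block mean: measurable, equivariant under the block-face reflections, half-local -/

section BlockMean

variable (N : ℕ) [NeZero N] (M : Fin (d + 1) → ℕ) [∀ μ, NeZero (M μ)] (κ : Fin (d + 1))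

omit [NeZero N] [∀ μ, NeZero (M μ)] in
/-- A real matrix acts measurably: `φ ↦ Aφ` is measurable (finite sums of coordinates). [folklore] -/
theorem measurable_mulVec_real {X Y : Type*} [Fintype X] [Fintype Y] (A : Matrix Y X ℝ) : Measurable fun φ : X → ℝ => A *ᵥ φ := by
  refine measurable_pi_lambda _ fun y => ?_
  simp only [Matrix.mulVec, dotProduct]
  exact Finset.measurable_sum _ fun x _ => (measurable_pi_apply x).const_mul _

/-- `Q(b, σz) = Q(σb, z)`. [cite: King1986, (2.10) p.652] -/
theorem Qmat_apply_torRefl_right (b : Tor M) (z : Tor (fine N M)) : Qmat N M b (torRefl (fine N M) κ z) = Qmat N M (torRefl M κ b) z := by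
  rw [← Qmat_torRefl N M κ b (torRefl (fine N M) κ z), torRefl_torRefl]

/-- ★ **THE BLOCK MEAN IS EQUIVARIANT UNDER THE BLOCK-FACE REFLECTIONS**: `Q(φ∘σ_fine) = (Qφ)∘σ_unit` («blocks go to blocks»). [cite: King1986, (2.10) p.652] [cite: FILS1978, §2] -/
theorem Qmat_mulVec_configReflect (φ : Tor (fine N M) → ℝ) :
    Qmat N M *ᵥ (configReflect (Function.Involutive.toPerm (torRefl (fine N M) κ) torRefl_torRefl) φ)
      = configReflect (Function.Involutive.toPerm (torRefl M κ) torRefl_torRefl) (Qmat N M *ᵥ φ) := by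
  funext b
  show (Qmat N M *ᵥ fun z => φ (torRefl (fine N M) κ z)) b = (Qmat N M *ᵥ φ) (torRefl M κ b)
  simp only [Matrix.mulVec, dotProduct]
  calc ∑ z, Qmat N M b z * φ (torRefl (fine N M) κ z)
      = ∑ z, Qmat N M b (torRefl (fine N M) κ z) * φ (torRefl (fine N M) κ (torRefl (fine N M) κ z)) :=
        (sum_torRefl (κ := κ) (fun z => Qmat N M b z * φ (torRefl (fine N M) κ z))).symm
    _ = ∑ z, Qmat N M (torRefl M κ b) z * φ z := Finset.sum_congr rfl fun z _ => by rw [torRefl_torRefl, Qmat_apply_torRefl_right]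

/-- ★ **THE BLOCK MEAN IS HALF-LOCAL**: for `M_κ` even, the block coordinate `(Qφ)(b)` of a block `b` in the unit half torus `{val b_κ < M_κ∕2}` is measurable in the fine
coordinates of the fine half torus `{val x_κ < N·M_κ∕2}` (its block lies there). [cite: King1986, (2.10) p.652] [cite: Biskup2009, §5.1 Def. 5.2] -/
theorem measurable_Qmat_coord_half (hM : Even (M κ)) (b : Tor M) (hb : b ∈ {b : Tor M | (b κ).val < M κ / 2}) :
    Measurable[positiveEvents (S := ℝ) {x : Tor (fine N M) | (x κ).val < fine N M κ / 2}] fun φ : Tor (fine N M) → ℝ => (Qmat N M *ᵥ φ) b := by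
  simp only [Matrix.mulVec, dotProduct]
  refine Finset.measurable_sum _ fun z _ => ?_
  by_cases hz : blockOf N M z = b
  · have hzP : z ∈ {x : Tor (fine N M) | (x κ).val < fine N M κ / 2} := (mem_half_fine_iff N M κ hM z).mpr (hz ▸ hb)
    exact (measurable_cylinderEvent_apply (i := z) hzP).const_mul _
  · have h0 : Qmat N M b z = 0 := by rw [Qmat_apply_eq, if_neg hz]
    simp only [h0, zero_mul]
    exact measurable_const

/-- The block mean is `positiveEvents (fine half) → positiveEvents (unit half)` measurable (`M_κ` even). [cite: Biskup2009, §5.1 Def. 5.2] -/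
theorem measurable_Qmat_positiveEvents (hM : Even (M κ)) :
    @Measurable _ _ (positiveEvents (S := ℝ) {x : Tor (fine N M) | (x κ).val < fine N M κ / 2})
      (positiveEvents (S := ℝ) {b : Tor M | (b κ).val < M κ / 2}) fun φ : Tor (fine N M) → ℝ => Qmat N M *ᵥ φ :=
  measurable_positiveEvents_of_coord fun b hb => measurable_Qmat_coord_half N M κ hM b hb

end BlockMean

/-! ## §2 Block averaging preserves reflection positivity -/

section Preserve

variable (N : ℕ) [NeZero N] (M : Fin (d + 1) → ℕ) [∀ μ, NeZero (M μ)] (κ : Fin (d + 1))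

/-- ★★★ **BLOCK AVERAGING OVER REFLECTION-SYMMETRIC BLOCKS PRESERVES REFLECTION POSITIVITY**: if a law `μ` of fine-lattice fields on `Π ℤ∕(N·M_μ)` is reflection
positive for the block-face reflection `σ_κ` and the fine half torus, then the law `Q_*μ` of its block averages on `Π ℤ∕M_μ` is reflection positive for `σ_κ` and the
unit half torus `{val b_κ < M_κ∕2}`, on ALL bounded half-torus observables (`M_κ` even; any `μ`, Gaussian or not).
[cite: King1986, (2.10) p.652] [cite: FILS1978, §2, Thm. 2.1] [cite: Biskup2009, §5.1 Def. 5.2, Lemma 5.3] -/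
theorem blockAverage_isReflectionPositive (hM : Even (M κ)) {μ : Measure (Tor (fine N M) → ℝ)}
    (hμ : IsReflectionPositive μ (Function.Involutive.toPerm (torRefl (fine N M) κ) torRefl_torRefl) {x : Tor (fine N M) | (x κ).val < fine N M κ / 2}) :
    IsReflectionPositive (μ.map fun φ : Tor (fine N M) → ℝ => Qmat N M *ᵥ φ)
      (Function.Involutive.toPerm (torRefl M κ) torRefl_torRefl) {b : Tor M | (b κ).val < M κ / 2} :=
  hμ.map_of_equivariant (measurable_mulVec_real (Qmat N M)) (Qmat_mulVec_configReflect N M κ) (measurable_Qmat_positiveEvents N M κ hM)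

/-- The real form. [cite: FILS1978, §2] [cite: Biskup2009, §5.1 Def. 5.2] -/
theorem blockAverage_isReflectionPositiveReal (hM : Even (M κ)) {μ : Measure (Tor (fine N M) → ℝ)}
    (hμ : IsReflectionPositiveReal μ (Function.Involutive.toPerm (torRefl (fine N M) κ) torRefl_torRefl) {x : Tor (fine N M) | (x κ).val < fine N M κ / 2}) :
    IsReflectionPositiveReal (μ.map fun φ : Tor (fine N M) → ℝ => Qmat N M *ᵥ φ)
      (Function.Involutive.toPerm (torRefl M κ) torRefl_torRefl) {b : Tor M | (b κ).val < M κ / 2} :=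
  hμ.map_of_equivariant (measurable_mulVec_real (Qmat N M)) (Qmat_mulVec_configReflect N M κ) (measurable_Qmat_positiveEvents N M κ hM)

/-- Block averaging preserves reflection invariance (no parity needed). [cite: King1986, (2.10) p.652] [cite: FILS1978, §2] -/
theorem blockAverage_isReflectionInvariant {μ : Measure (Tor (fine N M) → ℝ)}
    (hμ : IsReflectionInvariant μ (Function.Involutive.toPerm (torRefl (fine N M) κ) torRefl_torRefl)) :
    IsReflectionInvariant (μ.map fun φ : Tor (fine N M) → ℝ => Qmat N M *ᵥ φ) (Function.Involutive.toPerm (torRefl M κ) torRefl_torRefl) :=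
  hμ.map_of_equivariant (measurable_mulVec_real (Qmat N M)) (Qmat_mulVec_configReflect N M κ)

end Preserve

/-! ## §3 The block averages of King's fine free field -/

section FineFree

variable (N : ℕ) [NeZero N] (M : Fin (d + 1) → ℕ) [∀ μ, NeZero (M μ)] (κ : Fin (d + 1))

/-- ★★ **THE LAW OF THE BLOCK AVERAGES `Qφ` OF KING's FINE FREE FIELD `φ ∼ ρ_B dφ = N(0, B⁻¹)` IS REFLECTION POSITIVE** for the block-face reflection and the unit half
torus (`M_κ` even, `c ≥ 0`, `m² > 0`) — part Ϗ-a pushed through `Q`. [cite: King1986, (2.10) p.652, (2.13) p.653, (4.4) p.670] [cite: GlimmJaffe1987, §7.10 Thm. 7.10.3] [cite: FILS1978, §2] -/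
theorem fineFreeBlockAverage_isReflectionPositive (hM : Even (M κ)) {c m2 : ℝ} (hc : 0 ≤ c) (hm : 0 < m2) :
    IsReflectionPositive ((gaussLaw (lapF (fine N M) c m2)).map fun φ : Tor (fine N M) → ℝ => Qmat N M *ᵥ φ)
      (Function.Involutive.toPerm (torRefl M κ) torRefl_torRefl) {b : Tor M | (b κ).val < M κ / 2} :=
  blockAverage_isReflectionPositive N M κ hM (gaussLaw_lapF_isReflectionPositive κ (even_fine N M κ hM) hc hm)

/-- … and reflection invariant. [cite: King1986, (2.10) p.652, (4.4) p.670] -/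
theorem fineFreeBlockAverage_isReflectionInvariant {c m2 : ℝ} (hc : 0 ≤ c) (hm : 0 < m2) :
    IsReflectionInvariant ((gaussLaw (lapF (fine N M) c m2)).map fun φ : Tor (fine N M) → ℝ => Qmat N M *ᵥ φ)
      (Function.Involutive.toPerm (torRefl M κ) torRefl_torRefl) :=
  blockAverage_isReflectionInvariant N M κ (gaussLaw_lapF_isReflectionInvariant κ hc hm)

end FineFree

end Summit.QuantumFields.YangMills.BalabanUVNodes.N15KingModelRung.TorusRP
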